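import Summits.NavierStokesRegularity.FluidComputer.PalasekTowerGermHostSymmetry
import Literature.Analysis.FluidPDE.NewtonPotentialGradient

/-!
# The germ host, VII: the pressure gradient as an INTEGRAL — the anchor test of a composite design in closed form

Cell `ns-blowup`, seat `ns-blowup-ecbridge-3` (g3); GROUP C «BRIDGE SUPPORT» of the route
`PalasekTowerBreakdown` (crux `EpisodeBaseG`, item stmt-NavierStokesRegularity-19179, R2 of record).
LABEL: E–C typing (KERNEL, proofs only). WHAT THIS IS NOT: not Navier–Stokes evidence — integral
representations of the NS acceleration of a PRESCRIBED profile; no flow, stage or tower is built and no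
profile is claimed to pass the test.

## What and why

`PalasekTowerGermHostSymmetry` (p447482) reduced the STRICT ANCHOR TEST of a symmetric composite design
`U = U₁ + U₂` (carrier `U₁` even about the argmax `x₀`, far structures `U₂`, disjoint supports) to ONE
number, `−⟪U₁(x₀), ∇π[U₂](x₀)⟫`, the work of the far structures' pressure gradient along `U₁(x₀)`. This
file writes that number as an explicit, ν-free integral over the far structures: by the tree's first-order
Newtonian calculus (`fderiv_integral_newtonKernel_mul_apply`: derivatives fall on the source;
`integral_newtonKernel_smul_fderiv_eq`: they move onto the kernel, Gilbarg–Trudinger Lemma 4.1) and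
`div(νΔU − (U·∇)U) = −div((U·∇)U)` (`divergence_drift`, seat ecbridge-4),

  `⟪∇π[U](y), a⟫ = −∫ ∂ₐΓ(y − x) · div((U·∇)U)(x) dx`,  `∂ₐΓ(z) = ⟪z, a⟫ / (4π‖z‖³)`

(`inner_gradient_pot_eq_neg_integral`, every `y`; `…_explicit` off `tsupport U`), so that
(**`anchor_test_iff_integral`**) the strict test of the composite at `x₀` reads

  `−ν⟪U₁(x₀), ΔU₁(x₀)⟫ < ∫ ⟪x₀ − x, U₁(x₀)⟫ / (4π‖x₀ − x‖³) · div((U₂·∇)U₂)(x) dx`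

— a criterion on the DATA `(U₁, U₂, x₀)` alone: `div((U₂·∇)U₂) = tr((DU₂)²) = |S|² − ½|ω|²` has zero
mean, so the far structures pass the test when their STRAIN-dominated parts see `x₀` under a larger
dipole weight `⟪x₀ − x, U₁(x₀)⟫/‖x₀ − x‖³` than their VORTICITY-dominated parts (to leading order in
size/distance: the first moment of `tr((DU₂)²)` must point along `∇` of the weight). Nothing here
chooses `U₂`; a kernel instance of `LevelZeroData` is one explicit moment computation away.

References: D. Gilbarg, N. S. Trudinger, *Elliptic PDE of Second Order* (2001), Lemma 4.1
[cite: GilbargTrudinger2001, Lemma 4.1]; A. J. Majda, A. L. Bertozzi, *Vorticity and Incompressible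
Flow* (CUP 2002), §1.8 Prop. 1.16 [cite: MajdaBertozziCUP2002, §1.8 Prop. 1.16].
-/

noncomputable section

namespace Summit.NavierStokesRegularity.FluidComputer.PalasekTowerClayBridge.Germ

open Set Function Filter Topology InnerProductSpace Metric MeasureTheory
open scoped Topology ContDiff RealInnerProductSpace Laplacian

open Literature.Analysis.FluidPDE

variable {ν : ℝ} {U : EuclideanSpace ℝ (Fin 3) → EuclideanSpace ℝ (Fin 3)}

/-! ## §1 The pressure gradient as an integral against the dipole kernel -/

/-- **`⟪∇π(y), a⟫ = ∫ ∂ₐΓ(y − x) · div W(x) dx`** for the pressure potential `π = Δ⁻¹ div W`,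
`W = νΔU − (U·∇)U`, of a test profile, at EVERY point `y` (derivative on the source, then moved onto
the kernel by the first-order integration by parts against `Γ`). [cite: GilbargTrudinger2001, Lemma 4.1] -/
theorem inner_gradient_pot_eq_integral (hU : ContDiff ℝ ∞ U) (hUc : HasCompactSupport U) (ν : ℝ)
    (y a : EuclideanSpace ℝ (Fin 3)) :
    ⟪gradient (pot ν U) y, a⟫ =
      ∫ x, fderiv ℝ newtonKernel (y - x) a * VectorCalculus.divergence (drift ν U) x := by
  set G : EuclideanSpace ℝ (Fin 3) → ℝ := VectorCalculus.divergence (drift ν U) with hG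
  have hW := contDiff_drift hU ν
  have hWc := hasCompactSupport_drift (U := U) hUc ν
  have hGs : ContDiff ℝ ∞ G := contDiff_divergence_of_contDiff_top hW
  have hGc : HasCompactSupport G := CalderonSplittingLp.hasCompactSupport_divergence hWc
  have e : pot ν U = fun y => ∫ x, newtonKernel (y - x) * G x := funext (divPotential_apply _)
  rw [gradient, InnerProductSpace.toDual_symm_apply, e,
    fderiv_integral_newtonKernel_mul_apply hGs hGc y a]
  have h := integral_newtonKernel_smul_fderiv_eq (F := ℝ) (hGs.of_le (by norm_cast)) hGc y a
  simpa only [smul_eq_mul] using h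

/-- **`⟪∇π(y), a⟫ = −∫ ∂ₐΓ(y − x) · div((U·∇)U)(x) dx`** for a divergence-free test profile
(`div W = −div((U·∇)U)`): the viscosity drops out. [cite: GilbargTrudinger2001, Lemma 4.1] -/
theorem inner_gradient_pot_eq_neg_integral (hU : ContDiff ℝ ∞ U) (hUc : HasCompactSupport U)
    (hdiv : VectorCalculus.IsDivFree U) (ν : ℝ) (y a : EuclideanSpace ℝ (Fin 3)) :
    ⟪gradient (pot ν U) y, a⟫ =
      -∫ x, fderiv ℝ newtonKernel (y - x) a * VectorCalculus.divergence (convect U U) x := by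
  rw [inner_gradient_pot_eq_integral hU hUc ν y a, ← integral_neg]
  refine integral_congr_ae (Eventually.of_forall fun x => ?_)
  simp only [divergence_drift hU hdiv x]
  ring

/-- Off the profile's support the self-convection and its divergence vanish. [folklore] -/
theorem divergence_convect_eq_zero_of_notMem_tsupport {x : EuclideanSpace ℝ (Fin 3)}
    (hx : x ∉ tsupport U) : VectorCalculus.divergence (convect U U) x = 0 := by
  refine divergence_eq_zero_of_notMem_tsupport fun h => hx ?_
  have hsub : support (convect U U) ⊆ support U := by
    intro z hz
    rw [mem_support] at hz ⊢
    intro hUz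
    exact hz (by rw [convect_apply, hUz, map_zero])
  exact closure_mono hsub h

/-- **Explicit kernel off the support**: for `y ∉ tsupport U`,
`⟪∇π(y), a⟫ = −∫ ⟪y − x, a⟫ / (4π‖y − x‖³) · div((U·∇)U)(x) dx` (where the source is non-zero,
`x ≠ y` and `∂ₐΓ(y − x) = ⟪y − x, a⟫/(4π‖y − x‖³)`). [cite: GilbargTrudinger2001, Lemma 4.1] -/
theorem inner_gradient_pot_eq_neg_integral_explicit (hU : ContDiff ℝ ∞ U) (hUc : HasCompactSupport U)
    (hdiv : VectorCalculus.IsDivFree U) (ν : ℝ) {y : EuclideanSpace ℝ (Fin 3)} (hy : y ∉ tsupport U)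
    (a : EuclideanSpace ℝ (Fin 3)) :
    ⟪gradient (pot ν U) y, a⟫ =
      -∫ x, ⟪y - x, a⟫ / (4 * Real.pi * ‖y - x‖ ^ 3) * VectorCalculus.divergence (convect U U) x := by
  rw [inner_gradient_pot_eq_neg_integral hU hUc hdiv ν y a]
  congr 1
  refine integral_congr_ae (Eventually.of_forall fun x => ?_)
  by_cases hx : x ∈ tsupport U
  · have hne : y - x ≠ 0 := sub_ne_zero.2 fun h => hy (h ▸ hx)
    simp only [fderiv_newtonKernel_apply hne]
  · simp only [divergence_convect_eq_zero_of_notMem_tsupport hx, mul_zero]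

/-! ## §2 The anchor test of a symmetric composite design, in closed form -/

/-- **THE STRICT ANCHOR TEST OF A SYMMETRIC COMPOSITE DESIGN AS AN EXPLICIT INEQUALITY.** Let
`U = U₁ + U₂` with `U₁, U₂ ∈ C_c^∞` divergence free of DISJOINT supports, `U₁` EVEN about `x₀`,
`x₀ ∉ tsupport U₂`. Then the strict test at `x₀` holds iff
`−ν⟪U₁(x₀), ΔU₁(x₀)⟫ < ∫ ⟪x₀ − x, U₁(x₀)⟫ / (4π‖x₀ − x‖³) · div((U₂·∇)U₂)(x) dx` — the viscous braking
of the carrier against the dipole-weighted strain/vorticity imbalance of the far structures.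
[cite: MajdaBertozziCUP2002, §1.8 Prop. 1.16] -/
theorem anchor_test_iff_integral {U₁ U₂ : EuclideanSpace ℝ (Fin 3) → EuclideanSpace ℝ (Fin 3)}
    {x₀ : EuclideanSpace ℝ (Fin 3)} (h₁ : ContDiff ℝ ∞ U₁) (h₁c : HasCompactSupport U₁)
    (hdiv₁ : VectorCalculus.IsDivFree U₁) (he : IsEvenAbout x₀ U₁)
    (h₂ : ContDiff ℝ ∞ U₂) (h₂c : HasCompactSupport U₂) (hdiv₂ : VectorCalculus.IsDivFree U₂)
    (hd : Disjoint (tsupport U₁) (tsupport U₂)) (hx₀ : x₀ ∉ tsupport U₂) :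
    0 < ⟪(U₁ + U₂) x₀, accel ν (U₁ + U₂) x₀⟫ ↔
      -(ν * ⟪U₁ x₀, (Δ U₁) x₀⟫) <
        ∫ x, ⟪x₀ - x, U₁ x₀⟫ / (4 * Real.pi * ‖x₀ - x‖ ^ 3) *
          VectorCalculus.divergence (convect U₂ U₂) x := by
  rw [anchor_test_iff_of_even_add_far h₁ h₁c hdiv₁ he h₂ h₂c hd hx₀,
    ← real_inner_comm (U₁ x₀) (gradient (pot ν U₂) x₀),
    inner_gradient_pot_eq_neg_integral_explicit h₂ h₂c hdiv₂ ν hx₀ (U₁ x₀)]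
  constructor <;> intro h <;> linarith

/-- **The value of the test**, same hypotheses:
`⟪U(x₀), V(x₀)⟫ = ν⟪U₁(x₀), ΔU₁(x₀)⟫ + ∫ ⟪x₀ − x, U₁(x₀)⟫/(4π‖x₀ − x‖³) · div((U₂·∇)U₂)(x) dx`. [folklore] -/
theorem inner_accel_eq_integral {U₁ U₂ : EuclideanSpace ℝ (Fin 3) → EuclideanSpace ℝ (Fin 3)}
    {x₀ : EuclideanSpace ℝ (Fin 3)} (h₁ : ContDiff ℝ ∞ U₁) (h₁c : HasCompactSupport U₁)
    (hdiv₁ : VectorCalculus.IsDivFree U₁) (he : IsEvenAbout x₀ U₁)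
    (h₂ : ContDiff ℝ ∞ U₂) (h₂c : HasCompactSupport U₂) (hdiv₂ : VectorCalculus.IsDivFree U₂)
    (hd : Disjoint (tsupport U₁) (tsupport U₂)) (hx₀ : x₀ ∉ tsupport U₂) :
    ⟪(U₁ + U₂) x₀, accel ν (U₁ + U₂) x₀⟫ =
      ν * ⟪U₁ x₀, (Δ U₁) x₀⟫ +
        ∫ x, ⟪x₀ - x, U₁ x₀⟫ / (4 * Real.pi * ‖x₀ - x‖ ^ 3) *
          VectorCalculus.divergence (convect U₂ U₂) x := by
  rw [inner_accel_of_even_add_far h₁ h₁c hdiv₁ he h₂ h₂c hd hx₀,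
    ← real_inner_comm (U₁ x₀) (gradient (pot ν U₂) x₀),
    inner_gradient_pot_eq_neg_integral_explicit h₂ h₂c hdiv₂ ν hx₀ (U₁ x₀)]
  ring

end Summit.NavierStokesRegularity.FluidComputer.PalasekTowerClayBridge.Germ

end
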